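import Literature.NumberTheory.EllipticCurves.FineSelmerLayerCriterionRat
import Literature.NumberTheory.EllipticCurves.FineSelmerClassGroupCriterionTorsionPointFieldEigen
import Mathlib.NumberTheory.Padics.HeightOneSpectrum
import HarnessLib

/-!
# Door L5 with the class-group datum on ONE torsion-point field of the layer: Conjecture A for `E/ℚ`
# from the `S`-split tautological eigenspace of `Cl(ℚ_{n+1}(P))` (proofs only: no definition, no named fact)

`Proofs` file in topic `NumberTheory/EllipticCurves` (seat `bsd-potss-conjA-anchor` g18, follow-up (ii) of the
memo *door L5 as a kernel theorem*).  The door `CoatesSujatha2005.conjA_of_homTrivial_layer'` (file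
`FineSelmerLayerCriterionRat`) derives statement (A) of Coates–Sujatha for `E/ℚ` at an odd prime `p` from
(c1) `p ∤ #Gal(ℚ(E[p])/ℚ)`, the local conditions (c3′)/(c3*) at the bad primes, and the class-group datum
(c2)_{S,n+1}: «every `Γ_ℚ`-equivariant additive `Cl(𝓞_{L}) → E[p]`, `L = ℚ(E[p])ℚ_{n+1}`, killing the classes of
the primes above `S = {p} ∪ bad` is zero».  The field `L` has degree `#Gal(ℚ(E[p])/ℚ) · p^{n+1}` (`48`, `144`, …
at `p = 3`, `n = 0`), out of reach of class-group computations; the cell's numerical engines work on the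
torsion-point field `ℚ_{n+1}(P)` (degree `8 · 3 = 24` at `p = 3`).  This file moves the datum there:

* `DeoRaySujatha2023.equivariantHom_classGroup_eq_zero_of_eigenHom_subfield_of_factor` — the abstract
  eigen-lemma of `FineSelmerClassGroupCriterionTorsionPointFieldEigen` (g13's «Lemma‴») with its hypothesis
  `p ∤ #Gal(L/F)` FACTORED into `p ∤ #Gal(L₀/F)` for a Galois `L₀/F` through which `Γ_F` acts on `V`, and
  `p ∤ [L : K]`; so that it applies to `L = ℚ(E[p])ℚ_{n+1}` (degree divisible by `p`), `L₀ = ℚ(E[p])`,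
  `K = ℚ_{n+1}(P)`.  Proof verbatim (character-weighted averaging over the stabiliser of `𝔽_p P` in
  `Gal(L₀/F)`; descent `μ̃ = μ ∘ i_{L/K}`; Neukirch III (1.6)(iv); irreducibility).
* `CoatesSujatha2005.conjA_of_eigenHom_subfield_layer` — **(A) for `E/ℚ` at `p` odd from: `E[p]` irreducible,
  (c1), `κ` cyclotomic, a layer index `n`, bad places with (c3′) «`D_q ⊄ Gal(ℚ̄/ℚ_{n+1})`» or (c3*)
  «`E[p]^{D_q} = 0`», a subfield `K ⊆ L = ℚ(E[p])ℚ_{n+1}` with `Γ_K` fixing a point `P ≠ 0` of `E[p]` and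
  `p ∤ [L : K]` (`K = ℚ_{n+1}(P)`), and the `S`-split tautological-eigenspace condition on `Cl(𝓞_K) ⊗ 𝔽_p`**
  (every additive `μ : Cl(𝓞_K) → ℤ/p` with `μ([σ̄ I]) = a μ([I])` whenever `σ̄ = τ|_K`, `τ P = a P`, killing the
  classes of the primes of `K` above `p` and above the bad places, vanishes — a fortiori when
  `p ∤ #(Cl(𝓞_K)/⟨[𝔮] : 𝔮 ∣ S⟩)`).  NO hypothesis at the prime `p` itself.

HONEST FRAMING: theorems only, no new facts; nothing about BSD is claimed; the remaining displayed
hypotheses of a per-curve record are the image datum (c1)+irreducibility, the local data at the bad primes,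
the subfield `K` with `p ∤ [L:K]`, and the eigenspace datum on `Cl(𝓞_K)`.

## References

* [CoatesSujatha2005] J. Coates, R. Sujatha, *Fine Selmer groups of elliptic curves over `p`-adic Lie
  extensions*, Math. Ann. 331 (2005), §3 Thm. 3.4, Lemma 3.8.
* [DeoRaySujatha2023] S. V. Deo, A. Ray, R. Sujatha, *On the μ equals zero conjecture for fine Selmer
  groups in Iwasawa theory*, PAMQ 19 (2023), §3 Thm. 3.8 (c2), definition of `H′_L` (arXiv:2202.09937 p. 9).
* [NeukirchANT1999] J. Neukirch, *Algebraic Number Theory* (1999), Ch. III §1 Prop. (1.6) (iv).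
* [Washington1997] L. C. Washington, *Introduction to Cyclotomic Fields*, 2nd ed., §13.1.
-/

set_option autoImplicit false

noncomputable section

open scoped Classical

/-! ## §1 The factored eigen-lemma -/

namespace Literature.NumberTheory.EllipticCurves.DeoRaySujatha2023

open WeierstrassCurve IsDedekindDomain NumberField Field
open Literature.NumberTheory.GaloisRepresentations Literature.NumberTheory.NumberFields
open scoped nonZeroDivisors

/-! ### Elementary helpers -/

/-- An element killed by two coprime natural numbers is zero. [folklore] -/
private theorem eq_zero_of_nsmul_eq_zero_of_coprime' {M : Type*} [AddMonoid M] {a b : ℕ}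
    (hab : a.Coprime b) {x : M} (ha : a • x = 0) (hb : b • x = 0) : x = 0 := by
  have hord : addOrderOf x ∣ 1 := by
    rw [← hab]
    exact Nat.dvd_gcd (addOrderOf_dvd_of_nsmul_eq_zero ha) (addOrderOf_dvd_of_nsmul_eq_zero hb)
  exact AddMonoid.addOrderOf_eq_one_iff.mp (Nat.dvd_one.mp hord)

/-- Restriction `Γ_F → Gal(L/F)` to a normal subextension of `F̄/F` is onto (Mathlib
`AlgEquiv.restrictNormalHom_surjective`). [folklore] -/
private theorem absRestrictNormalHom_surjective'' {F : Type*} [Field F]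
    (E : IntermediateField F (AlgebraicClosure F)) [Normal F E] :
    Function.Surjective (absRestrictNormalHom E) := fun g => by
  obtain ⟨σ, hσ⟩ := AlgEquiv.restrictNormalHom_surjective (AlgebraicClosure F) g
  exact ⟨(absoluteGaloisGroup.toAlgEquiv F).symm σ, hσ⟩

/-- **An additive map on ideal classes that kills the class of every prime containing `q` kills the class of
every non-zero ideal containing `q`** (unique factorisation of ideals in the Dedekind domain `R`: such an
ideal is a product of primes each of which contains `q`). [folklore]
[cite: NeukirchANT1999, Ch. I §3 Thm. (3.3) (unique prime factorisation of ideals)] -/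
private theorem map_mk0_eq_zero_of_mem {R : Type*} [CommRing R] [IsDedekindDomain R]
    {A : Type*} [AddCommGroup A] (f : Additive (ClassGroup R) →+ A) (q : R)
    (hq : ∀ (𝔓 : Ideal R) (h𝔓 : 𝔓 ≠ ⊥), 𝔓.IsPrime → q ∈ 𝔓 →
      f (Additive.ofMul (ClassGroup.mk0 ⟨𝔓, mem_nonZeroDivisors_of_ne_zero h𝔓⟩)) = 0)
    (I : Ideal R) (hI : I ≠ ⊥) (hqI : q ∈ I) :
    f (Additive.ofMul (ClassGroup.mk0 ⟨I, mem_nonZeroDivisors_of_ne_zero hI⟩)) = 0 := by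
  -- induction along the prime factorisation of `I`
  have key : ∀ J : Ideal R, ∀ (hJ : J ≠ ⊥), q ∈ J →
      f (Additive.ofMul (ClassGroup.mk0 ⟨J, mem_nonZeroDivisors_of_ne_zero hJ⟩)) = 0 := by
    intro J
    refine UniqueFactorizationMonoid.induction_on_prime J ?_ ?_ ?_
    · intro h0; exact absurd rfl h0
    · intro J hJu _ _
      have hJ1 : J = ⊤ := Ideal.isUnit_iff.mp hJu
      have h1 : (⟨J, mem_nonZeroDivisors_of_ne_zero (by rw [hJ1]; exact top_ne_bot)⟩ : (Ideal R)⁰) = 1 :=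
        Subtype.ext (by rw [OneMemClass.coe_one, Ideal.one_eq_top]; exact hJ1)
      have : ∀ h, f (Additive.ofMul (ClassGroup.mk0 ⟨J, h⟩)) = 0 := by
        intro h
        have hh : (⟨J, h⟩ : (Ideal R)⁰) = 1 := by rw [← h1]
        rw [hh, map_one, ofMul_one, map_zero]
      exact this _
    · intro J P hJ0 hP ih hJP hqJP
      have hP0 : P ≠ ⊥ := hP.ne_zero
      have hPprime : P.IsPrime := Ideal.isPrime_of_prime hP
      have hJ : J ≠ ⊥ := hJ0
      have hqP : q ∈ P := Ideal.mul_le_right (hqJP)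
      have hqJ : q ∈ J := Ideal.mul_le_left (hqJP)
      have hprod : (⟨P * J, mem_nonZeroDivisors_of_ne_zero hJP⟩ : (Ideal R)⁰) =
          ⟨P, mem_nonZeroDivisors_of_ne_zero hP0⟩ * ⟨J, mem_nonZeroDivisors_of_ne_zero hJ⟩ :=
        Subtype.ext rfl
      rw [hprod, map_mul, ofMul_mul, map_add, hq P hP0 hPprime hqP, ih hJ hqJ, add_zero]
  exact key I hI hqI

/-- The extension `𝔞𝓞_L` of a nonzero ideal `𝔞` of `𝓞 K` is nonzero. [folklore] -/
private theorem extend_mem_nonZeroDivisors {K L : Type*} [Field K] [Field L] [Algebra K L]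
    (I : (Ideal (𝓞 K))⁰) :
    (I : Ideal (𝓞 K)).map (algebraMap (𝓞 K) (𝓞 L)) ∈ (Ideal (𝓞 L))⁰ := by
  refine mem_nonZeroDivisors_of_ne_zero fun h => nonZeroDivisors.coe_ne_zero I ?_
  exact (Ideal.map_eq_bot_iff_of_injective (FaithfulSMul.algebraMap_injective (𝓞 K) (𝓞 L))).mp h

/-! ### The abstract statement -/

set_option maxHeartbeats 800000 in
/-- **Equivariant homomorphisms `Cl(𝓞_L) → V` killing the `S`-classes vanish when every `S`-split
tautological eigenfunctional on `Cl(𝓞_K)` vanishes — FACTORED form.**  Same statement and proof as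
`equivariantHom_classGroup_eq_zero_of_eigenHom_subfield` (file
`FineSelmerClassGroupCriterionTorsionPointFieldEigen`), with its hypothesis `p ∤ #Gal(L/F)` split in the two
places where the proof uses it: (a) the `Γ_F`-action on `V` factors through a finite Galois `L₀/F` with
`p ∤ #Gal(L₀/F)` (`hV`: `Γ_{L₀}` acts trivially; the character-weighted average is taken over the stabiliser of
the line `𝔽_p P` in `Gal(L₀/F)`), and (b) `p ∤ [L : K]` (`hLK`; the descent `#Gal(L/K) · μ = μ̃ ∘ N_{L/K}`).
`L` itself may have degree divisible by `p` — the case of the layers `L = L₀ F_n` of a `ℤ_p`-extension, `K = F_n(P)`.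
Setting otherwise unchanged: `L/F` finite Galois inside `F̄`, `V` a `p`-torsion `Γ_F`-module whose only
`Γ_F`-stable subgroups are `⊥` and `⊤`, `K ⊆ L` with `Γ_K` fixing `P ≠ 0`, `S ⊆ ℕ`; hypothesis `hEig` and
conclusion verbatim as in the unfactored theorem. [folklore]
[cite: NeukirchANT1999, Ch. III §1 Prop. (1.6) (iv)] [cite: DeoRaySujatha2023, §3 Thm. 3.8 (c2) and the definition of H′_L (arXiv:2202.09937 p. 9)] -/
theorem equivariantHom_classGroup_eq_zero_of_eigenHom_subfield_of_factor
    {F : Type} [Field F] (L : IntermediateField F (AlgebraicClosure F)) [FiniteDimensional F L]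
    [IsGalois F L] [NumberField L] (p : ℕ) [Fact p.Prime]
    (L₀ : IntermediateField F (AlgebraicClosure F)) [FiniteDimensional F L₀] [IsGalois F L₀]
    (hG₀ : ¬ p ∣ Nat.card (L₀ ≃ₐ[F] L₀))
    {V : Type*} [AddCommGroup V] [DistribMulAction (absoluteGaloisGroup F) V]
    (hV : ∀ τ : absoluteGaloisGroup F, absRestrictNormalHom L₀ τ = 1 → ∀ v : V, τ • v = v)
    (hpV : ∀ v : V, p • v = 0)
    (hirr : ∀ U : AddSubgroup V,
      (∀ τ : absoluteGaloisGroup F, ∀ v ∈ U, τ • v ∈ U) → U = ⊥ ∨ U = ⊤)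
    (K : IntermediateField F L) [NumberField K]
    (P : V) (hP0 : P ≠ 0)
    (hPK : ∀ τ : absoluteGaloisGroup F, (∀ x : K, absRestrictNormalHom L τ (x : L) = x) → τ • P = P)
    (hLK : ¬ p ∣ Module.finrank K L)
    (S : Set ℕ)
    (hEig : ∀ μ : Additive (ClassGroup (𝓞 K)) →+ ZMod p,
      (∀ (τ : absoluteGaloisGroup F) (σ : K ≃ₐ[F] K) (a : ℕ),
          (∀ x : K, absRestrictNormalHom L τ (x : L) = ((σ x : K) : L)) → τ • P = a • P →
          ∀ (I J : (Ideal (𝓞 K))⁰),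
            (J : Ideal (𝓞 K)) = (I : Ideal (𝓞 K)).map (AmbiguousClass.intAut σ : 𝓞 K →+* 𝓞 K) →
            μ (Additive.ofMul (ClassGroup.mk0 J)) = a • μ (Additive.ofMul (ClassGroup.mk0 I))) →
      (∀ (𝔮 : HeightOneSpectrum (𝓞 K)) (q : ℕ), q ∈ S → ((q : ℕ) : 𝓞 K) ∈ 𝔮.asIdeal →
          μ (Additive.ofMul (ClassGroup.mk0
            ⟨𝔮.asIdeal, mem_nonZeroDivisors_of_ne_zero 𝔮.ne_bot⟩)) = 0) →
      μ = 0)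
    (f : Additive (ClassGroup (𝓞 L)) →+ V)
    (hf : ∀ (τ : absoluteGaloisGroup F) (I J : (Ideal (𝓞 L))⁰),
      (J : Ideal (𝓞 L)) =
        (I : Ideal (𝓞 L)).map (AmbiguousClass.intAut (absRestrictNormalHom L τ) : 𝓞 L →+* 𝓞 L) →
      f (Additive.ofMul (ClassGroup.mk0 J)) = τ • f (Additive.ofMul (ClassGroup.mk0 I)))
    (hfS : ∀ (𝔓 : HeightOneSpectrum (𝓞 L)) (q : ℕ), q ∈ S → ((q : ℕ) : 𝓞 L) ∈ 𝔓.asIdeal →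
      f (Additive.ofMul (ClassGroup.mk0
        ⟨𝔓.asIdeal, mem_nonZeroDivisors_of_ne_zero 𝔓.ne_bot⟩)) = 0) :
    f = 0 := by
  have hp : p.Prime := Fact.out
  -- (S) elements of `Γ_F` with the same restriction to `L` act identically on `V`
  have hS : ∀ τ τ' : absoluteGaloisGroup F,
      absRestrictNormalHom L₀ τ = absRestrictNormalHom L₀ τ' → ∀ v : V, τ • v = τ' • v := by
    intro τ τ' h v
    have h1 : absRestrictNormalHom L₀ (τ'⁻¹ * τ) = 1 := by
      rw [map_mul, map_inv, h, inv_mul_cancel]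
    calc τ • v = (τ' * (τ'⁻¹ * τ)) • v := by rw [mul_inv_cancel_left]
      _ = τ' • v := by rw [mul_smul, hV _ h1 v]
  -- `τ • (n • v) = n • (τ • v)`
  have hsm : ∀ (τ : absoluteGaloisGroup F) (n : ℕ) (v : V), τ • (n • v) = n • (τ • v) :=
    fun τ n v => map_nsmul (DistribSMul.toAddMonoidHom V τ) n v
  -- the `𝔽_p`-structure on `V`
  letI instM : Module (ZMod p) V := AddCommGroup.zmodModule hpV
  have hcast : ∀ (n : ℕ) (v : V), (n : ZMod p) • v = n • v := fun n v => Nat.cast_smul_eq_nsmul _ n v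
  -- scalars along the line `𝔽_p P` are unique
  have huniq : ∀ a b : ZMod p, a • P = b • P → a = b := by
    intro a b hab
    by_contra hne
    have hsub : (a - b) • P = 0 := by rw [sub_smul, hab, sub_self]
    have hab0 : a - b ≠ 0 := sub_ne_zero.mpr hne
    apply hP0
    calc P = (a - b)⁻¹ • ((a - b) • P) := by rw [smul_smul, inv_mul_cancel₀ hab0, one_smul]
      _ = 0 := by rw [hsub, smul_zero]
  -- lifts `Γ_F → Gal(L₀/F)`
  choose lift₀ hlift₀ using absRestrictNormalHom_surjective'' L₀
  -- the action of `G₀ = Gal(L₀/F)` on `V` through lifts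
  set act : (L₀ ≃ₐ[F] L₀) → V → V := fun g v => lift₀ g • v with hact
  have hact_res : ∀ (τ : absoluteGaloisGroup F) (v : V),
      act (absRestrictNormalHom L₀ τ) v = τ • v := fun τ v => hS _ _ (hlift₀ _) v
  have hact_mul : ∀ (g h : L₀ ≃ₐ[F] L₀) (v : V), act (g * h) v = act g (act h v) := by
    intro g h v
    change lift₀ (g * h) • v = lift₀ g • lift₀ h • v
    rw [← mul_smul]
    exact hS _ _ (by rw [hlift₀, map_mul, hlift₀, hlift₀]) v
  have hact_one : ∀ v : V, act 1 v = v := fun v => hV _ (hlift₀ 1) v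
  have hact_nsmul : ∀ (g : L₀ ≃ₐ[F] L₀) (n : ℕ) (v : V), act g (n • v) = n • act g v :=
    fun g n v => hsm _ n v
  have hact_zero : ∀ g : L₀ ≃ₐ[F] L₀, act g 0 = 0 := fun g => smul_zero _
  -- the stabiliser `T` of the line through `P`
  let T : Subgroup (L₀ ≃ₐ[F] L₀) :=
    { carrier := {g | ∃ a b : ℕ, act g P = a • P ∧ act g⁻¹ P = b • P}
      one_mem' := ⟨1, 1, by rw [hact_one, one_smul], by rw [inv_one, hact_one, one_smul]⟩
      mul_mem' := by
        rintro g h ⟨a, b, hga, hgb⟩ ⟨c, d, hhc, hhd⟩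
        refine ⟨c * a, b * d, ?_, ?_⟩
        · rw [hact_mul, hhc, hact_nsmul, hga, mul_smul]
        · rw [mul_inv_rev, hact_mul, hgb, hact_nsmul, hhd, mul_smul]
      inv_mem' := by
        rintro g ⟨a, b, hga, hgb⟩
        exact ⟨b, a, hgb, by rw [inv_inv]; exact hga⟩ }
  have hmemT : ∀ g : L₀ ≃ₐ[F] L₀, g ∈ T ↔ ∃ a b : ℕ, act g P = a • P ∧ act g⁻¹ P = b • P :=
    fun g => Iff.rfl
  -- `#T` is prime to `p` (Lagrange)
  have hTG : Nat.card T ∣ Nat.card (L₀ ≃ₐ[F] L₀) := Subgroup.card_subgroup_dvd_card T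
  have hTp : ¬ p ∣ Nat.card T := fun h => hG₀ (h.trans hTG)
  have hTcast : (Nat.card T : ZMod p) ≠ 0 := by
    rw [Ne, ZMod.natCast_eq_zero_iff]
    exact hTp
  -- the scalars `a_t` (`t ⋆ P = a_t • P`), as units of `𝔽_p`
  have hsc : ∀ t : T, ∃ a : ℕ, act (t : L₀ ≃ₐ[F] L₀) P = a • P := fun t => by
    obtain ⟨a, b, ha, _⟩ := (hmemT t).mp t.2
    exact ⟨a, ha⟩
  choose sc hsc' using hsc
  have hsc0 : ∀ t : T, (sc t : ZMod p) ≠ 0 := by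
    intro t h0
    obtain ⟨a, b, ha, hb⟩ := (hmemT t).mp t.2
    have h1 : act (t : L₀ ≃ₐ[F] L₀) P = 0 := by rw [hsc' t, ← hcast, h0, zero_smul]
    apply hP0
    calc P = act ((t : L₀ ≃ₐ[F] L₀)⁻¹ * t) P := by rw [inv_mul_cancel, hact_one]
      _ = 0 := by rw [hact_mul, h1, hact_zero]
  -- multiplicativity of the scalars: `a_{u t} = a_u a_t` in `𝔽_p`
  have hsc_mul : ∀ u t : T, ((sc (u * t) : ℕ) : ZMod p) = (sc u : ZMod p) * (sc t : ZMod p) := by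
    intro u t
    apply huniq
    rw [hcast, ← hsc', Subgroup.coe_mul, hact_mul, hsc' t, hact_nsmul, hsc' u, ← mul_smul, ← hcast,
      Nat.cast_mul, mul_comm]
  -- the character-weighted average `π`
  set π : V →+ V :=
    ∑ t : T, ((sc t : ZMod p)⁻¹) • DistribSMul.toAddMonoidHom V (lift₀ (t : L₀ ≃ₐ[F] L₀)) with hπdef
  have hπ : ∀ v : V, π v = ∑ t : T, ((sc t : ZMod p)⁻¹) • act (t : L₀ ≃ₐ[F] L₀) v := by
    intro v
    rw [hπdef, AddMonoidHom.finsetSum_apply]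
    rfl
  -- `π(t₀ ⋆ v) = a_{t₀} • π(v)`
  have hπ_act : ∀ (t₀ : T) (v : V), π (act (t₀ : L₀ ≃ₐ[F] L₀) v) = (sc t₀ : ZMod p) • π v := by
    intro t₀ v
    rw [hπ, hπ, Finset.smul_sum]
    rw [Fintype.sum_equiv (Equiv.mulRight t₀)
      (fun t : T => ((sc t : ZMod p)⁻¹) • act (t : L₀ ≃ₐ[F] L₀) (act (t₀ : L₀ ≃ₐ[F] L₀) v))
      (fun u : T => ((sc (u * t₀⁻¹) : ZMod p)⁻¹) • act (u : L₀ ≃ₐ[F] L₀) v) ?_]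
    · refine Finset.sum_congr rfl fun u _ => ?_
      have h1 : ((sc (u * t₀⁻¹) : ℕ) : ZMod p) = (sc u : ZMod p) * ((sc t₀ : ZMod p))⁻¹ := by
        have h2 := hsc_mul (u * t₀⁻¹) t₀
        rw [inv_mul_cancel_right] at h2
        exact (eq_mul_inv_iff_mul_eq₀ (hsc0 t₀)).mpr h2.symm
      have hscu : (((sc (u * t₀⁻¹) : ℕ) : ZMod p))⁻¹ = (sc t₀ : ZMod p) * ((sc u : ZMod p))⁻¹ := by
        rw [h1, mul_inv, inv_inv, mul_comm]
      rw [hscu, mul_smul]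
    · intro t
      change ((sc t : ZMod p)⁻¹) • act (t : L₀ ≃ₐ[F] L₀) (act (t₀ : L₀ ≃ₐ[F] L₀) v) =
        ((sc (t * t₀ * t₀⁻¹) : ZMod p)⁻¹) • act ((t * t₀ : T) : L₀ ≃ₐ[F] L₀) v
      rw [mul_inv_cancel_right, Subgroup.coe_mul, hact_mul]
  -- `π P = #T • P ≠ 0`
  have hπP : π P = (Nat.card T) • P := by
    rw [hπ]
    have key : ∀ t : T, ((sc t : ZMod p)⁻¹) • act (t : L₀ ≃ₐ[F] L₀) P = P := by
      intro t
      rw [hsc' t, ← hcast, smul_smul, inv_mul_cancel₀ (hsc0 t), one_smul]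
    simp_rw [key]
    rw [Finset.sum_const, Finset.card_univ, Nat.card_eq_fintype_card]
  have hπP0 : π P ≠ 0 := by
    intro h0
    rw [hπP, ← hcast] at h0
    apply hP0
    calc P = ((Nat.card T : ZMod p))⁻¹ • ((Nat.card T : ZMod p) • P) := by
          rw [smul_smul, inv_mul_cancel₀ hTcast, one_smul]
      _ = 0 := by rw [h0, smul_zero]
  -- a separating `𝔽_p`-functional and the tautological eigenfunctional `ε = λ ∘ π`
  haveI instF : Module.Free (ZMod p) V := @Module.Free.of_divisionRing (ZMod p) V _ _ instM
  haveI instP : Module.Projective (ZMod p) V :=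
    @Module.Projective.of_free (ZMod p) _ V _ instM instF
  obtain ⟨lam, hlam⟩ := @Module.Projective.exists_dual_ne_zero V _ (ZMod p) _ instM instP _ hπP0
  set ε : V →+ ZMod p := lam.toAddMonoidHom.comp π with hεdef
  have hε : ∀ v, ε v = lam.toAddMonoidHom (π v) := fun v => rfl
  have hεP : ε P ≠ 0 := by rw [hε]; exact hlam
  -- the eigen-property of `ε`: `ε (τ • v) = a • ε v` whenever `τ • P = a • P`
  have hε_eig : ∀ (τ : absoluteGaloisGroup F) (a : ℕ), τ • P = a • P →
      ∀ v : V, ε (τ • v) = a • ε v := by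
    intro τ a hτ v
    have ha0 : (a : ZMod p) ≠ 0 := by
      intro h0
      have h1 : τ • P = 0 := by rw [hτ, ← hcast, h0, zero_smul]
      apply hP0
      calc P = τ⁻¹ • (τ • P) := by rw [smul_smul, inv_mul_cancel, one_smul]
        _ = 0 := by rw [h1, smul_zero]
    obtain ⟨b, hbcast⟩ : ∃ b : ℕ, (b : ZMod p) = ((a : ZMod p))⁻¹ :=
      ⟨((a : ZMod p)⁻¹).val, ZMod.natCast_zmod_val _⟩
    have hgT : absRestrictNormalHom L₀ τ ∈ T := by
      refine ⟨a, b, ?_, ?_⟩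
      · rw [hact_res, hτ]
      · have h1 : act (absRestrictNormalHom L₀ τ)⁻¹ (τ • P) = P := by
          rw [← hact_res τ P, ← hact_mul, inv_mul_cancel, hact_one]
        rw [hτ, hact_nsmul] at h1
        calc act (absRestrictNormalHom L₀ τ)⁻¹ P
            = ((b : ZMod p) * (a : ZMod p)) • act (absRestrictNormalHom L₀ τ)⁻¹ P := by
                rw [hbcast, inv_mul_cancel₀ ha0, one_smul]
          _ = b • (a • act (absRestrictNormalHom L₀ τ)⁻¹ P) := by rw [mul_smul, hcast, hcast]
          _ = b • P := by rw [h1]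
    have key := hπ_act ⟨_, hgT⟩ v
    have hsca : ((sc ⟨_, hgT⟩ : ℕ) : ZMod p) = (a : ZMod p) := by
      apply huniq
      rw [hcast, hcast, ← hsc' ⟨_, hgT⟩]
      change act (absRestrictNormalHom L₀ τ) P = a • P
      rw [hact_res, hτ]
    rw [hε, hε, ← hact_res τ v, key, hsca]
    simp only [LinearMap.toAddMonoidHom_coe]
    rw [LinearMap.map_smul, smul_eq_mul, nsmul_eq_mul]
  -- `μ = ε ∘ f` on `Cl_L` and its descent `μK = μ ∘ i_{L/K}` to `Cl_K`
  set μ : Additive (ClassGroup (𝓞 L)) →+ ZMod p := ε.comp f with hμdef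
  have hμ : ∀ c, μ c = ε (f c) := fun c => rfl
  set μK : Additive (ClassGroup (𝓞 K)) →+ ZMod p :=
    μ.comp (MonoidHom.toAdditive (classGroupExtend K L)) with hμKdef
  have hμK : ∀ d : ClassGroup (𝓞 K),
      μK (Additive.ofMul d) = μ (Additive.ofMul (classGroupExtend K L d)) := fun d => rfl
  -- (i) `μK` is a tautological eigenfunctional
  have hμK_eig : ∀ (τ : absoluteGaloisGroup F) (σ : K ≃ₐ[F] K) (a : ℕ),
      (∀ x : K, absRestrictNormalHom L τ (x : L) = ((σ x : K) : L)) → τ • P = a • P →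
      ∀ (I J : (Ideal (𝓞 K))⁰),
        (J : Ideal (𝓞 K)) = (I : Ideal (𝓞 K)).map (AmbiguousClass.intAut σ : 𝓞 K →+* 𝓞 K) →
        μK (Additive.ofMul (ClassGroup.mk0 J)) = a • μK (Additive.ofMul (ClassGroup.mk0 I)) := by
    intro τ σ a hτσ hτP I J hJ
    rw [hμK, hμK, classGroupExtend_mk0, classGroupExtend_mk0, hμ, hμ]
    -- `J 𝓞_L = (τ|_L)(I 𝓞_L)`
    have hJL : ((J : Ideal (𝓞 K)).map (algebraMap (𝓞 K) (𝓞 L))) =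
        ((I : Ideal (𝓞 K)).map (algebraMap (𝓞 K) (𝓞 L))).map
          (AmbiguousClass.intAut (absRestrictNormalHom L τ) : 𝓞 L →+* 𝓞 L) := by
      rw [hJ, Ideal.map_map, Ideal.map_map]
      congr 1
      refine RingHom.ext fun y => RingOfIntegers.ext ?_
      rw [RingHom.comp_apply, RingHom.comp_apply, RingHom.coe_coe, RingHom.coe_coe,
        RingOfIntegers.mapRingEquiv_apply]
      exact (hτσ (y : K)).symm
    rw [hf τ ⟨_, extend_mem_nonZeroDivisors (L := L) I⟩ ⟨_, extend_mem_nonZeroDivisors (L := L) J⟩ hJL]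
    exact hε_eig τ a hτP _
  -- (ii) `μK` kills the classes of the primes of `K` above `S`
  have hμK_S : ∀ (𝔮 : HeightOneSpectrum (𝓞 K)) (q : ℕ), q ∈ S → ((q : ℕ) : 𝓞 K) ∈ 𝔮.asIdeal →
      μK (Additive.ofMul (ClassGroup.mk0
        ⟨𝔮.asIdeal, mem_nonZeroDivisors_of_ne_zero 𝔮.ne_bot⟩)) = 0 := by
    intro 𝔮 q hq hq𝔮
    rw [hμK, classGroupExtend_mk0, hμ]
    have hne : (𝔮.asIdeal.map (algebraMap (𝓞 K) (𝓞 L))) ≠ ⊥ :=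
      nonZeroDivisors.coe_ne_zero
        (⟨_, extend_mem_nonZeroDivisors (L := L)
          ⟨𝔮.asIdeal, mem_nonZeroDivisors_of_ne_zero 𝔮.ne_bot⟩⟩ : (Ideal (𝓞 L))⁰)
    have hqL : ((q : ℕ) : 𝓞 L) ∈ 𝔮.asIdeal.map (algebraMap (𝓞 K) (𝓞 L)) := by
      have h1 := Ideal.mem_map_of_mem (algebraMap (𝓞 K) (𝓞 L)) hq𝔮
      rwa [map_natCast] at h1
    have key : f (Additive.ofMul (ClassGroup.mk0
        ⟨𝔮.asIdeal.map (algebraMap (𝓞 K) (𝓞 L)), mem_nonZeroDivisors_of_ne_zero hne⟩)) = 0 := by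
      refine map_mk0_eq_zero_of_mem f ((q : ℕ) : 𝓞 L) ?_ _ hne hqL
      intro 𝔓 h𝔓 hprime hq𝔓
      exact hfS ⟨𝔓, hprime, h𝔓⟩ q hq hq𝔓
    rw [key, map_zero]
  have hμK0 : μK = 0 := hEig μK hμK_eig hμK_S
  -- the subgroup `H = Gal(L/K)`, of order prime to `p`, fixes `P`: `μ` is `H`-invariant
  have hcardH : Fintype.card (L ≃ₐ[K] L) = Module.finrank K L := by
    rw [← Nat.card_eq_fintype_card]; exact IsGalois.card_aut_eq_finrank K L
  have hH : ¬ p ∣ Fintype.card (L ≃ₐ[K] L) := by rw [hcardH]; exact hLK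
  -- lifts `Γ_F → Gal(L/F)`
  choose lift hlift using absRestrictNormalHom_surjective'' L
  have hHcop : (Fintype.card (L ≃ₐ[K] L)).Coprime p :=
    Nat.coprime_comm.mp ((Nat.Prime.coprime_iff_not_dvd hp).mpr hH)
  set tl : (L ≃ₐ[K] L) → absoluteGaloisGroup F := fun h => lift (h.restrictScalars F) with htl
  have htl_res : ∀ h : L ≃ₐ[K] L, absRestrictNormalHom L (tl h) = h.restrictScalars F :=
    fun h => hlift _
  have htlP : ∀ h : L ≃ₐ[K] L, tl h • P = P := by
    intro h
    refine hPK _ fun x => ?_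
    rw [htl_res]
    exact h.commutes x
  have hμ_gal : ∀ (h : L ≃ₐ[K] L) (c : ClassGroup (𝓞 L)),
      μ (Additive.ofMul (ClassGroup.mulEquiv (AmbiguousClass.intAut h) c)) = μ (Additive.ofMul c) := by
    intro h c
    obtain ⟨I, rfl⟩ := ClassGroup.mk0_surjective c
    rw [AmbiguousClass.mulEquiv_mk0]
    have hJ : (((⟨_, AmbiguousClass.map_mem_nonZeroDivisors h I⟩ : (Ideal (𝓞 L))⁰) : (Ideal (𝓞 L))⁰) :
        Ideal (𝓞 L)) =
        (I : Ideal (𝓞 L)).map (AmbiguousClass.intAut (absRestrictNormalHom L (tl h)) : 𝓞 L →+* 𝓞 L) := by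
      rw [htl_res]
      rfl
    rw [hμ, hμ, hf (tl h) I _ hJ, hε_eig (tl h) 1 (by rw [htlP, one_smul]), one_smul]
  -- `#H · μ(c) = μ(i(N c)) = μK(N c) = 0`: `μ = 0`
  have hμ_norm : ∀ c : ClassGroup (𝓞 L),
      Fintype.card (L ≃ₐ[K] L) • μ (Additive.ofMul c) =
        μ (Additive.ofMul (classGroupExtend K L (classGroupNorm K L c))) := by
    intro c
    rw [classGroupExtend_classGroupNorm_eq_prod K L c, ofMul_prod, map_sum]
    simp_rw [hμ_gal]
    rw [Finset.sum_const, Finset.card_univ]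
  have hpZ : ∀ m : ZMod p, p • m = 0 := fun m => by
    rw [nsmul_eq_mul, ZMod.natCast_self, zero_mul]
  have hμ0 : ∀ a, μ a = 0 := by
    intro a
    have hm : μ (Additive.ofMul (classGroupExtend K L (classGroupNorm K L (Additive.toMul a)))) = 0 := by
      rw [← hμK, hμK0, AddMonoidHom.zero_apply]
    refine eq_zero_of_nsmul_eq_zero_of_coprime' hHcop ?_ (hpZ _)
    rw [← ofMul_toMul a, hμ_norm, hm]
  -- the `Γ_F`-stable subgroup `U = {v : ε(τ v) = 0 ∀ τ}` contains `f(Cl_L)` but not `P`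
  set U : AddSubgroup V :=
    ⨅ τ : absoluteGaloisGroup F, (ε.comp (DistribSMul.toAddMonoidHom V τ)).ker with hUdef
  have hmemU : ∀ v : V, v ∈ U ↔ ∀ τ : absoluteGaloisGroup F, ε (τ • v) = 0 := by
    intro v
    rw [hUdef, AddSubgroup.mem_iInf]
    refine forall_congr' fun τ => ?_
    rw [AddMonoidHom.mem_ker]
    rfl
  have hUstab : ∀ τ : absoluteGaloisGroup F, ∀ v ∈ U, τ • v ∈ U := by
    intro τ v hv
    rw [hmemU] at hv ⊢
    intro τ'
    rw [← mul_smul]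
    exact hv _
  have hUP : P ∉ U := by
    intro hPU
    rw [hmemU] at hPU
    exact hεP (by simpa using hPU 1)
  have hUbot : U = ⊥ := by
    rcases hirr U hUstab with h | h
    · exact h
    · exact absurd (h ▸ AddSubgroup.mem_top P) hUP
  have hfU : ∀ a, f a ∈ U := by
    intro a
    obtain ⟨I, hI⟩ := ClassGroup.mk0_surjective (Additive.toMul a)
    have ha : a = Additive.ofMul (ClassGroup.mk0 I) := by rw [hI, ofMul_toMul]
    rw [hmemU, ha]
    intro τ
    rw [← hf τ I ⟨_, AmbiguousClass.map_mem_nonZeroDivisors (absRestrictNormalHom L τ) I⟩ rfl, ← hμ]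
    exact hμ0 _
  ext a
  have : f a ∈ (⊥ : AddSubgroup V) := hUbot ▸ hfU a
  rwa [AddSubgroup.mem_bot] at this

end Literature.NumberTheory.EllipticCurves.DeoRaySujatha2023

/-! ## §2 `E/ℚ`: the door with the eigenspace datum on a torsion-point field of the layer -/

section RatEigen

open scoped Pointwise nonZeroDivisors
open NumberField Field IntermediateField IsDedekindDomain WeierstrassCurve
open Literature.NumberTheory.GaloisRepresentations Literature.NumberTheory.NumberFields
open Literature.NumberTheory.EllipticCurves Literature.NumberTheory.EllipticCurves.GreenbergSelmer

namespace Literature.NumberTheory.EllipticCurves.CoatesSujatha2005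

variable {p : ℕ} [Fact p.Prime]

/-- Two finite places of `ℚ` containing the same prime number coincide (`q_u = q = q_v`, Mathlib
`Rat.HeightOneSpectrum.primesEquiv`). [folklore] -/
private theorem eq_of_natCast_mem {u v : HeightOneSpectrum (𝓞 ℚ)} {q : ℕ} (hq : q.Prime)
    (hqu : (q : 𝓞 ℚ) ∈ u.asIdeal) (hqv : (q : 𝓞 ℚ) ∈ v.asIdeal) : u = v := by
  have key : ∀ w : HeightOneSpectrum (𝓞 ℚ), (q : 𝓞 ℚ) ∈ w.asIdeal →
      Rat.HeightOneSpectrum.natGenerator w = q := by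
    intro w hw
    have h1 : ((q : ℕ) : ℤ) ∈ w.asIdeal.map (Rat.IsIntegralClosure.intEquiv (𝓞 ℚ)) := by
      have := Ideal.mem_map_of_mem (Rat.IsIntegralClosure.intEquiv (𝓞 ℚ)) hw
      rwa [map_natCast] at this
    exact (Nat.prime_dvd_prime_iff_eq (Rat.HeightOneSpectrum.prime_natGenerator w) hq).mp
      ((Rat.HeightOneSpectrum.natGenerator_dvd_iff w).mpr h1)
  apply Rat.HeightOneSpectrum.primesEquiv.injective
  apply Subtype.ext
  show Rat.HeightOneSpectrum.natGenerator u = Rat.HeightOneSpectrum.natGenerator v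
  rw [key u hqu, key v hqv]

set_option synthInstance.maxHeartbeats 200000 in
set_option maxHeartbeats 800000 in
/-- **Conjecture A for `E/ℚ` from the `S`-split tautological eigenspace of `Cl(ℚ_{n+1}(P))`** (door L5 of the
cell with the class-group datum moved to a torsion-point field of the layer).  `E/ℚ` elliptic (`W`), `p` odd,
`E[p]` irreducible, (c1) `p ∤ #Gal(ℚ(E[p])/ℚ)`, `κ` the cyclotomic `ℤ_p`-extension, `n : ℕ`, `bad` a set of
finite places with, at each, (c3′) `¬ (D_u ≤ κ.layerSubgroup (n+1))` or (c3*) `E[p]^{D_u} = 0`; `K` a subfield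
of `L = ℚ(E[p])ℚ_{n+1}` whose absolute Galois group fixes `P ∈ E[p] ∖ 0`, with `p ∤ [L : K]`; and every additive
`μ : Cl(𝓞_K) → ℤ/p` that is a tautological eigenfunctional (`μ([σ̄ I]) = a • μ([I])` for `σ̄ = τ|_K`,
`τ • P = a • P`) and kills the class of every prime of `K` above `p` or above a bad place, vanishes.  Then
statement (A) holds for `E` at `p` (`∃ γ D`, `X` finitely generated over `ℤ_p`).  Proof:
`conjA_of_homTrivial_layer'` + `equivariantHom_classGroup_eq_zero_of_eigenHom_subfield_of_factor` with
`L₀ = ℚ(E[p])`, `S = {p} ∪ {q : q lies under a bad place}`.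
[cite: CoatesSujatha2005, §3 Thm. 3.4 and Lemma 3.8]
[cite: DeoRaySujatha2023, §3 Thm. 3.8 (c2) and the definition of H′_L (arXiv:2202.09937 p. 9)]
[cite: NeukirchANT1999, Ch. III §1 Prop. (1.6) (iv)] [cite: Washington1997, §13.1] -/
theorem conjA_of_eigenHom_subfield_layer
    (W : WeierstrassCurve ℚ) [W.IsElliptic] (hp2 : p ≠ 2)
    (hirr : W.HasIrreducibleModPGaloisRep p)
    (hG : ¬ p ∣ Nat.card ((W.divisionField p) ≃ₐ[ℚ] (W.divisionField p)))
    {κ : ZpExtension ℚ p} (hκ : κ.IsCyclotomic) (n : ℕ)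
    (bad : HeightOneSpectrum (𝓞 ℚ) → Prop)
    (hbad : ∀ u : HeightOneSpectrum (𝓞 ℚ), bad u →
      ¬ (GreenbergSelmer.decomp u ≤ κ.layerSubgroup (n + 1)) ∨
      (∀ x : geomTorsion W (p : ℤ), (∀ d ∈ GreenbergSelmer.decomp u, d • x = x) → x = 0))
    (K : IntermediateField ℚ ↥(W.divisionField p ⊔ κ.layer (n + 1))) [NumberField K]
    (P : geomTorsion W (p : ℤ)) (hP0 : P ≠ 0)
    (hPK : haveI := κ.isGalois_layer_holds (n + 1)
      ∀ τ : absoluteGaloisGroup ℚ,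
        (∀ x : K, absRestrictNormalHom (W.divisionField p ⊔ κ.layer (n + 1)) τ
          (x : ↥(W.divisionField p ⊔ κ.layer (n + 1))) = x) → τ • P = P)
    (hLK : ¬ p ∣ Module.finrank K ↥(W.divisionField p ⊔ κ.layer (n + 1)))
    (hEig : haveI := κ.isGalois_layer_holds (n + 1)
      ∀ μ : Additive (ClassGroup (𝓞 K)) →+ ZMod p,
      (∀ (τ : absoluteGaloisGroup ℚ) (σ : K ≃ₐ[ℚ] K) (a : ℕ),
          (∀ x : K, absRestrictNormalHom (W.divisionField p ⊔ κ.layer (n + 1)) τ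
              (x : ↥(W.divisionField p ⊔ κ.layer (n + 1))) =
            ((σ x : K) : ↥(W.divisionField p ⊔ κ.layer (n + 1)))) → τ • P = a • P →
          ∀ (I J : (Ideal (𝓞 K))⁰),
            (J : Ideal (𝓞 K)) = (I : Ideal (𝓞 K)).map (AmbiguousClass.intAut σ : 𝓞 K →+* 𝓞 K) →
            μ (Additive.ofMul (ClassGroup.mk0 J)) = a • μ (Additive.ofMul (ClassGroup.mk0 I))) →
      (∀ (𝔮 : HeightOneSpectrum (𝓞 K)) (q : ℕ) (v : HeightOneSpectrum (𝓞 ℚ)), q.Prime →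
          ((q : ℕ) : 𝓞 K) ∈ 𝔮.asIdeal → ((q : ℕ) : 𝓞 ℚ) ∈ v.asIdeal →
          (((p : ℕ) : 𝓞 ℚ) ∈ v.asIdeal ∨ bad v) →
          μ (Additive.ofMul (ClassGroup.mk0
            ⟨𝔮.asIdeal, mem_nonZeroDivisors_of_ne_zero 𝔮.ne_bot⟩)) = 0) →
      μ = 0) :
    ∃ (γ : absoluteGaloisGroup ℚ) (D : W.FineSelmerDualData κ γ),
      Module.Finite ℤ_[p] (RestrictScalars ℤ_[p] (IwasawaAlgebra p) D.X) := by
  have hpp : p.Prime := Fact.out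
  haveI : NeZero p := ⟨hpp.ne_zero⟩
  haveI := κ.isGalois_layer_holds (n + 1)
  haveI := κ.finiteDimensional_layer_holds (n + 1)
  haveI hNF : NumberField ↥(W.divisionField p ⊔ κ.layer (n + 1)) := NumberField.of_module_finite ℚ _
  refine conjA_of_homTrivial_layer' W hp2 hG hκ n bad hbad ?_
  intro f hf hfS
  -- `W[p]` is `p`-torsion
  have hpV : ∀ v : geomTorsion W (p : ℤ), p • v = 0 := by
    intro v
    apply Subtype.ext
    have hv : ((v : geomTorsion W (p : ℤ)) : geomPoints W) ∈
        AddSubgroup.torsionBy (geomPoints W) (p : ℤ) := v.2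
    rw [AddSubgroup.torsionBy, Submodule.mem_toAddSubgroup, Submodule.mem_torsionBy_iff] at hv
    rw [AddSubgroupClass.coe_nsmul, ZeroMemClass.coe_zero, ← natCast_zsmul]
    exact hv
  -- the set `S` of rational primes under `{p} ∪ bad`
  let S : Set ℕ := {q | q.Prime ∧ ∃ v : HeightOneSpectrum (𝓞 ℚ),
    ((q : ℕ) : 𝓞 ℚ) ∈ v.asIdeal ∧ (((p : ℕ) : 𝓞 ℚ) ∈ v.asIdeal ∨ bad v)}
  refine DeoRaySujatha2023.equivariantHom_classGroup_eq_zero_of_eigenHom_subfield_of_factor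
    (W.divisionField p ⊔ κ.layer (n + 1)) p (W.divisionField p) hG
    (fun τ hτ v => (W.absRestrictNormalHom_divisionField_eq_one_iff p τ).mp hτ v) hpV hirr K P hP0
    hPK hLK S ?_ f ?_ ?_
  · -- the eigen-hypothesis, with `S` unfolded
    intro μ hμ1 hμ2
    refine hEig μ hμ1 ?_
    intro 𝔮 q v hq hq𝔮 hqv hv
    exact hμ2 𝔮 q ⟨hq, v, hqv, hv⟩ hq𝔮
  · -- equivariance: the `mulEquiv` phrasing of `hL5` gives the `Ideal.map` phrasing
    intro τ I J hJ
    have hJ' : ClassGroup.mk0 J =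
        ClassGroup.mulEquiv (AmbiguousClass.intAut
          (absRestrictNormalHom (W.divisionField p ⊔ κ.layer (n + 1)) τ)) (ClassGroup.mk0 I) := by
      rw [AmbiguousClass.mulEquiv_mk0]
      congr 1
      exact Subtype.ext hJ
    rw [hJ']
    exact hf τ (ClassGroup.mk0 I)
  · -- the `S`-condition of `hL5` (places) gives the `S`-condition of the lemma (prime numbers)
    rintro 𝔓 q ⟨hq, v, hqv, hv⟩ hq𝔓
    refine hfS 𝔓 v hv ?_
    -- the place of `ℚ` under `𝔓` contains `q`, hence is `v`
    have hq0 : ((q : ℕ) : 𝓞 ℚ) ≠ 0 := by exact_mod_cast hq.ne_zero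
    have hmem : ((q : ℕ) : 𝓞 ℚ) ∈ 𝔓.asIdeal.under (𝓞 ℚ) := by
      rw [Ideal.under_def, Ideal.mem_comap, map_natCast]
      exact hq𝔓
    have hne : 𝔓.asIdeal.under (𝓞 ℚ) ≠ ⊥ := fun h0 => hq0 (by
      rw [h0, Ideal.mem_bot] at hmem
      exact hmem)
    let u : HeightOneSpectrum (𝓞 ℚ) := ⟨𝔓.asIdeal.under (𝓞 ℚ), Ideal.IsPrime.under _ _, hne⟩
    have hu : u = v := eq_of_natCast_mem hq hmem hqv
    exact congrArg HeightOneSpectrum.asIdeal hu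

end Literature.NumberTheory.EllipticCurves.CoatesSujatha2005

end RatEigen

end
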